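import Literature.Computability.AlgebraicComplexity.ConstituentStageCompatCount
import Literature.Computability.AlgebraicComplexity.MultiTypeClassCount
import Literature.Computability.AlgebraicComplexity.GlobalStageCompatProduct
import HarnessLib

/-!
# Def. 6.14 (Compatibility′) and the entropy bound on the number of compatible `Z`-blocks
(Vassilevska Williams–Xu–Xu–Zhou 2024, §6.6, proof of Claim 6.13: "there are constraints on the
complete split distributions of `K̂` on some disjoint subsets of level-`(ℓ−1)` positions … count the
number of valid subsequences of `K̂` for each of these subsets of indices, and multiply them together
… `= 2^{∑_t (H(α_t) + λ_{Z,t}) · A_{t,1} n_t ± o(n)}`") — proved (upper bound)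

Topic `Literature/Computability/AlgebraicComplexity`.  For an `{α_t}`-consistent level-`(ℓ−1)` block
triple of the constituent stage (`ConstituentStageStructure.ConstituentRegion`), a level-1 `Z`-block
compatible with it in the sense of Def. 6.9 satisfies Def. 6.14: exact splits `β_{Z,t,i',j',k'}` on the
border classes `S_{t,i',j',k'}` (`i' = 0` or `j' = 0`) and the forced weighted average `β̄_{Z,t,+,+,k'}`
on `S_{t,+,+,k'} = ⋃_{i',j' > 0} S_{t,i',j',k'}`.  These are constraints on DISJOINT classes, i.e.
admissibility for a COARSE one-level interface datum, whose block count is a multi-class type class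
bounded by Lemma 3.3.  This file PROVES:

* `pairClassPP` (`S_{t,+,+,k'}`), `card_filter_pairClassPP_eq_sum` (it decomposes over the interior of
  the box), `betaBarPP` (`β̄_{Z,t,+,+,k'}`), `completeSplitOn_pairClassPP_of_compatible` — **Def. 6.9 ⇒
  Def. 6.14 (2)** for consistent triples inside the level-`ℓ` blocks;
* `coarseTermMap₂`, `coarseTermList₂`, `mem_levelBlocksX_coarse₂_of_compatible` — compatible blocks are
  admissible for the coarse datum, so `compatCount_le_card_coarse` : `C(T) ≤ |levelBlocksX coarse 0|`;
* `compatCount_le_two_rpow` — **`C(T) ≤ 2^{∑_{classes} |class| · H(split of the class)}`**, the printed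
  `2^{λ_{Z,t} A_{t,1} n_t}` per term in exact (integral class sizes) form.

Everything is proved; the definitions are the coarse data; no named facts.

## References

* V. Vassilevska Williams, Y. Xu, Z. Xu, R. Zhou, *New bounds for matrix multiplication: from alpha
  to omega*, SODA 2024, arXiv:2307.07970 (held: `paper:arxiv-2307.07970`), §6.6: Def. 6.14 and the
  proof of Claim 6.13; §6.3 (`λ_{Z,t}`). [VassilevskaWilliamsXuXuZhou2024]
-/

noncomputable section

open scoped BigOperators
open Finset

namespace Literature.Computability.AlgebraicComplexity

/-! ## The classes `S_{t,+,+,k'}` and `β̄_{Z,t,+,+,k'}` -/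

section PlusPlus

variable {c n s : ℕ} (τ : Fin n → Fin s)

/-- **`S_{t,+,+,k'} = ⋃_{i',j'>0} S_{t,i',j',k'}`**: positions of term `t` with `K_p = k'`, `I_p ≠ 0`,
`J_p ≠ 0`. [cite: VassilevskaWilliamsXuXuZhou2024, Def. 6.14 (S_{t,+,+,k})] -/
def pairClassPP (I J K : Fin (n + n) → ℕ) (t : Fin s) (k : ℕ) : Finset (Fin (n + n)) :=
  univ.filter fun p => halfTermOf τ p = t ∧ K p = k ∧ I p ≠ 0 ∧ J p ≠ 0

/-- Membership. [folklore] -/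
@[simp] theorem mem_pairClassPP {I J K : Fin (n + n) → ℕ} {t : Fin s} {k : ℕ} {p : Fin (n + n)} :
    p ∈ pairClassPP τ I J K t k ↔ halfTermOf τ p = t ∧ K p = k ∧ I p ≠ 0 ∧ J p ≠ 0 := by
  simp [pairClassPP]

/-- `S_{t,+,+,k'}` is the part of `S_{t,*,*,k'}` off the border. [cite: VassilevskaWilliamsXuXuZhou2024, Def. 6.14] -/
theorem pairClassPP_eq_filter (I J K : Fin (n + n) → ℕ) (t : Fin s) (k : ℕ) :
    pairClassPP τ I J K t k = (pairClassZ τ K t k).filter fun p => ¬ (I p = 0 ∨ J p = 0) := by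
  ext p
  simp only [mem_pairClassPP, mem_filter, mem_pairClassZ, not_or]
  tauto

variable (L : Fin s → InterfaceTerm (c + c))

/-- **`S_{t,+,+,k'}` decomposes over the interior of the box**: for a level triple inside the level-`ℓ`
blocks, `#{p ∈ S_{t,+,+,k'} | Q p} = ∑_{box, i',j' ≠ 0} #{p ∈ S_{t,i',j',k'} | Q p}`. [cite: VassilevskaWilliamsXuXuZhou2024, Def. 6.14] -/
theorem card_filter_pairClassPP_eq_sum {I J K : Fin (n + n) → ℕ} (h : IsLevelTriple c I J K)
    (hI : ∀ u, I (Fin.castAdd n u) + I (Fin.natAdd n u) = (L (τ u)).i)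
    (hJ : ∀ u, J (Fin.castAdd n u) + J (Fin.natAdd n u) = (L (τ u)).j)
    (hK : ∀ u, K (Fin.castAdd n u) + K (Fin.natAdd n u) = (L (τ u)).k)
    (t : Fin s) (k : ℕ) (Q : Fin (n + n) → Prop) [DecidablePred Q] :
    ((pairClassPP τ I J K t k).filter Q).card =
      ∑ ijk ∈ (boxTriples c (L t) k).filter (fun ijk => ¬ (ijk.1 = 0 ∨ ijk.2.1 = 0)),
        ((pairClass τ I J K t ijk.1 ijk.2.1 ijk.2.2).filter Q).card := by
  rw [pairClassPP_eq_filter, filter_filter,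
    card_filter_pairClassZ_eq_sum τ L h hI hJ hK t k (fun p => ¬ (I p = 0 ∨ J p = 0) ∧ Q p),
    ← sum_filter_add_sum_filter_not (boxTriples c (L t) k) (fun ijk => ¬ (ijk.1 = 0 ∨ ijk.2.1 = 0))]
  have hzero : ∑ ijk ∈ (boxTriples c (L t) k).filter (fun ijk => ¬¬ (ijk.1 = 0 ∨ ijk.2.1 = 0)),
      ((pairClass τ I J K t ijk.1 ijk.2.1 ijk.2.2).filter fun p => ¬ (I p = 0 ∨ J p = 0) ∧ Q p).card = 0 := by
    refine sum_eq_zero fun ijk hijk => ?_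
    have hb : ijk.1 = 0 ∨ ijk.2.1 = 0 := not_not.1 (mem_filter.1 hijk).2
    rw [Finset.card_eq_zero, Finset.filter_eq_empty_iff]
    intro p hp
    rw [mem_pairClass] at hp
    rw [not_and]
    intro hnb
    apply absurd _ hnb
    rw [hp.2.1, hp.2.2.1]; exact hb
  rw [hzero, add_zero]
  refine sum_congr rfl fun ijk hijk => ?_
  have hint : ¬ (ijk.1 = 0 ∨ ijk.2.1 = 0) := (mem_filter.1 hijk).2
  refine congrArg Finset.card ?_
  ext p
  simp only [mem_filter, mem_pairClass]
  constructor
  · rintro ⟨hp, -, hq⟩; exact ⟨hp, hq⟩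
  · rintro ⟨hp, hq⟩
    refine ⟨hp, ?_, hq⟩
    rw [hp.2.1, hp.2.2.1]; exact hint

/-- **`β̄_{Z,t,+,+,k'}`**: the weighted average of the `β_{Z,t,i',j',k'}` over the INTERIOR of the box
(`i', j' ≠ 0`), weights `w(i',j',k') + w(i_t−i',j_t−j',k_t−k')`. [cite: VassilevskaWilliamsXuXuZhou2024, Def. 6.14 (β̄_{Z,t,+,+,k}) and §6.3 (λ_{Z,t})] -/
def betaBarPP (c : ℕ) (T : InterfaceTerm (c + c)) (w : ℕ × ℕ × ℕ → ℝ) (βZ : ℕ × ℕ × ℕ → (Fin c → Fin 3) → ℝ) (k : ℕ) :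
    (Fin c → Fin 3) → ℝ := fun σ =>
  (∑ ijk ∈ (boxTriples c T k).filter (fun ijk => ¬ (ijk.1 = 0 ∨ ijk.2.1 = 0)),
      (w ijk + w (T.i - ijk.1, T.j - ijk.2.1, T.k - ijk.2.2)) * βZ ijk σ) /
    ∑ ijk ∈ (boxTriples c T k).filter (fun ijk => ¬ (ijk.1 = 0 ∨ ijk.2.1 = 0)), (w ijk + w (T.i - ijk.1, T.j - ijk.2.1, T.k - ijk.2.2))

/-- **Def. 6.9 ⇒ Def. 6.14 (2)**: for an `{α_t}`-consistent triple inside the level-`ℓ` blocks and a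
compatible `K̂`, `split(K̂, S_{t,+,+,k'}) = β̄_{Z,t,+,+,k'}` on every non-empty `S_{t,+,+,k'}` (the border
classes being exact, the typicality average forces the interior average).
[cite: VassilevskaWilliamsXuXuZhou2024, Def. 6.14 ("it is not difficult to see that the following condition is equivalent")] -/
theorem completeSplitOn_pairClassPP_of_compatible {βZ : Fin s → ℕ × ℕ × ℕ → (Fin c → Fin 3) → ℝ} {cnt : Fin s → ℕ × ℕ × ℕ → ℕ}
    {I J K : Fin (n + n) → Fin (2 * c + 1)} (h : IsLevelTriple c (seqVal I) (seqVal J) (seqVal K))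
    (hI : InsideX τ L I) (hJ : InsideY τ L J) (hK : InsideZ τ L K) (hcnt : IsAlphaTConsistent τ cnt (seqVal I) (seqVal J) (seqVal K))
    {Kh : Fin (n + n) → Fin c → Fin 3} (hc : IsCompatibleWith₂ τ L (fun t ijk => (cnt t ijk : ℝ)) βZ (seqVal I) (seqVal J) (seqVal K) Kh)
    (t : Fin s) (k : ℕ) (hne : (pairClassPP τ (seqVal I) (seqVal J) (seqVal K) t k).Nonempty) :
    completeSplitOn Kh (pairClassPP τ (seqVal I) (seqVal J) (seqVal K) t k) = betaBarPP c (L t) (fun ijk => (cnt t ijk : ℝ)) (βZ t) k := by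
  obtain ⟨h1, htyp⟩ := hc
  funext σ
  set box := boxTriples c (L t) k with hbox
  set w : ℕ × ℕ × ℕ → ℝ := fun ijk => (cnt t ijk : ℝ) + cnt t ((L t).i - ijk.1, (L t).j - ijk.2.1, (L t).k - ijk.2.2) with hw
  -- class sizes `|S_{t,s}| = w s` in the box
  have hsize : ∀ ijk ∈ box, ((pairClass τ (seqVal I) (seqVal J) (seqVal K) t ijk.1 ijk.2.1 ijk.2.2).card : ℝ) = w ijk := by
    intro ijk hijk
    rw [hbox, mem_boxTriples] at hijk
    have e1 : (leftClass τ (seqVal I) (seqVal J) (seqVal K) t ijk.1 ijk.2.1 ijk.2.2).card = cnt t ijk := hcnt t ijk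
    have e2 : (leftClass τ (seqVal I) (seqVal J) (seqVal K) t ((L t).i - ijk.1) ((L t).j - ijk.2.1) ((L t).k - ijk.2.2)).card =
        cnt t ((L t).i - ijk.1, (L t).j - ijk.2.1, (L t).k - ijk.2.2) := hcnt t ((L t).i - ijk.1, (L t).j - ijk.2.1, (L t).k - ijk.2.2)
    rw [card_pairClass_eq τ L hI hJ hK t hijk.2.2.1 hijk.2.2.2.1 hijk.2.2.2.2, e1, e2, hw]
    push_cast; rfl
  -- the splits times sizes on the box classes: border exact, interior unknown
  have hZne : (pairClassZ τ (seqVal K) t k).Nonempty := by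
    obtain ⟨p, hp⟩ := hne
    exact ⟨p, by rw [mem_pairClassZ]; exact ⟨(mem_pairClassPP τ|>.1 hp).1, (mem_pairClassPP τ|>.1 hp).2.1⟩⟩
  have havg := completeSplitOn_pairClassZ_mul_card τ L h hI hJ hK Kh t k σ
  have hcardZ := card_pairClassZ_eq_sum τ L h hI hJ hK t k
  -- typicality: split(Z) |Z| = Σ_box w β
  have hT := congrFun (htyp t k hZne) σ
  have hWpos : (0 : ℝ) < ∑ ijk ∈ box, w ijk := by
    have : ((pairClassZ τ (seqVal K) t k).card : ℝ) = ∑ ijk ∈ box, w ijk := by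
      rw [hcardZ]; push_cast; exact sum_congr rfl hsize
    rw [← this]; exact_mod_cast hZne.card_pos
  have hZval : completeSplitOn Kh (pairClassZ τ (seqVal K) t k) σ * (pairClassZ τ (seqVal K) t k).card = ∑ ijk ∈ box, w ijk * βZ t ijk σ := by
    rw [hT, hcardZ]
    push_cast
    rw [sum_congr rfl hsize]
    simp only [betaBarZ, ← hbox]
    rw [div_mul_cancel₀ _ hWpos.ne']
  -- per class: border classes have split β (or are empty)
  have hterm : ∀ ijk ∈ box, (ijk.1 = 0 ∨ ijk.2.1 = 0) →
      completeSplitOn Kh (pairClass τ (seqVal I) (seqVal J) (seqVal K) t ijk.1 ijk.2.1 ijk.2.2) σ *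
          (pairClass τ (seqVal I) (seqVal J) (seqVal K) t ijk.1 ijk.2.1 ijk.2.2).card = w ijk * βZ t ijk σ := by
    intro ijk hijk hb
    rcases (pairClass τ (seqVal I) (seqVal J) (seqVal K) t ijk.1 ijk.2.1 ijk.2.2).eq_empty_or_nonempty with he | hne'
    · have h0 : w ijk = 0 := by rw [← hsize ijk hijk, he, card_empty, Nat.cast_zero]
      rw [he, card_empty, Nat.cast_zero, mul_zero, h0, zero_mul]
    · rw [h1 t _ _ _ hb hne', hsize ijk hijk, mul_comm]
  -- split the box sum into border and interior
  rw [hZval, ← sum_filter_add_sum_filter_not box (fun ijk => ijk.1 = 0 ∨ ijk.2.1 = 0),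
    ← sum_filter_add_sum_filter_not box (fun ijk => ijk.1 = 0 ∨ ijk.2.1 = 0)
      (fun ijk => completeSplitOn Kh (pairClass τ (seqVal I) (seqVal J) (seqVal K) t ijk.1 ijk.2.1 ijk.2.2) σ * _)] at havg
  rw [sum_congr rfl (fun ijk hijk => hterm ijk (mem_filter.1 hijk).1 (mem_filter.1 hijk).2)] at havg
  -- so the interior sums agree
  have hint : ∑ ijk ∈ box.filter (fun ijk => ¬ (ijk.1 = 0 ∨ ijk.2.1 = 0)),
      completeSplitOn Kh (pairClass τ (seqVal I) (seqVal J) (seqVal K) t ijk.1 ijk.2.1 ijk.2.2) σ *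
        (pairClass τ (seqVal I) (seqVal J) (seqVal K) t ijk.1 ijk.2.1 ijk.2.2).card =
      ∑ ijk ∈ box.filter (fun ijk => ¬ (ijk.1 = 0 ∨ ijk.2.1 = 0)), w ijk * βZ t ijk σ := by linarith
  -- the `+,+` class: its split times size is the interior sum, its size the interior weight
  have hPP : completeSplitOn Kh (pairClassPP τ (seqVal I) (seqVal J) (seqVal K) t k) σ * (pairClassPP τ (seqVal I) (seqVal J) (seqVal K) t k).card =
      ∑ ijk ∈ box.filter (fun ijk => ¬ (ijk.1 = 0 ∨ ijk.2.1 = 0)), w ijk * βZ t ijk σ := by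
    rw [completeSplitOn_mul_card, card_filter_pairClassPP_eq_sum τ L h hI hJ hK t k (fun p => Kh p = σ), ← hint]
    push_cast
    exact sum_congr rfl fun ijk _ => (completeSplitOn_mul_card Kh _ σ).symm
  have hPPcard : ((pairClassPP τ (seqVal I) (seqVal J) (seqVal K) t k).card : ℝ) =
      ∑ ijk ∈ box.filter (fun ijk => ¬ (ijk.1 = 0 ∨ ijk.2.1 = 0)), w ijk := by
    have := card_filter_pairClassPP_eq_sum τ L h hI hJ hK t k (fun _ => True)
    simp only [filter_true_of_mem (fun _ _ => trivial)] at this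
    rw [this]; push_cast
    exact sum_congr rfl fun ijk hijk => hsize ijk (mem_filter.1 hijk).1
  have hpos : (0 : ℝ) < (pairClassPP τ (seqVal I) (seqVal J) (seqVal K) t k).card := by exact_mod_cast hne.card_pos
  simp only [betaBarPP, ← hbox]
  rw [eq_div_iff (by rw [← hPPcard]; exact hpos.ne'), ← hPPcard]
  exact hPP

end PlusPlus

/-! ## The coarse datum of Def. 6.14 and the bound on `C` -/

section Coarse

variable {c n s : ℕ} (τ : Fin n → Fin s)

/-- **The coarse term map of a level-`(ℓ−1)` triple on half-chunk positions**: position `p ↦ (t(p),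
coarse class of `p`)` — the border class `S_{t,i',j',k'}` if `I_p = 0` or `J_p = 0`, else `S_{t,+,+,K_p}`.
[cite: VassilevskaWilliamsXuXuZhou2024, Def. 6.14] -/
def coarseTermMap₂ {I J K : Fin (n + n) → ℕ} (h : IsLevelTriple c I J K) : Fin (n + n) → Fin (s * (coarseClasses c).card) :=
  fun p => finProdFinEquiv (halfTermOf τ p, coarseTermMap h p)

/-- The split distribution attached to a coarse class of term `t`: `β_{Z,t,i',j',k'}` on a border class,
`β̄_{Z,t,+,+,k'}` (given as data `βPP t k'`) on `S_{t,+,+,k'}`. [cite: VassilevskaWilliamsXuXuZhou2024, Def. 6.14] -/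
def coarseBeta (βZ : Fin s → ℕ × ℕ × ℕ → (Fin c → Fin 3) → ℝ) (βPP : Fin s → ℕ → (Fin c → Fin 3) → ℝ) (t : Fin s) :
    Option (ℕ × ℕ) × ℕ → (Fin c → Fin 3) → ℝ
  | (some (i, j), k) => βZ t (i, j, k)
  | (none, k) => βPP t k

/-- **The coarse parameter list** (as `X`-data of one-level interface terms). [cite: VassilevskaWilliamsXuXuZhou2024, Def. 6.14 and Claim 6.13 (proof)] -/
def coarseTermList₂ (c s : ℕ) (βZ : Fin s → ℕ × ℕ × ℕ → (Fin c → Fin 3) → ℝ) (βPP : Fin s → ℕ → (Fin c → Fin 3) → ℝ) :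
    Fin (s * (coarseClasses c).card) → InterfaceTerm c := fun idx =>
  let ti := finProdFinEquiv.symm idx
  let cl : Option (ℕ × ℕ) × ℕ := ((coarseClasses c).equivFin.symm ti.2).1
  ⟨cl.2, 0, 0, coarseBeta βZ βPP ti.1 cl, coarseBeta βZ βPP ti.1 cl, coarseBeta βZ βPP ti.1 cl⟩

/-- The fibre of the coarse term map over `(t, class)`. [cite: VassilevskaWilliamsXuXuZhou2024, Def. 6.14] -/
theorem filter_coarseTermMap₂_eq {I J K : Fin (n + n) → ℕ} (h : IsLevelTriple c I J K) (t : Fin s) (cidx : Fin (coarseClasses c).card) :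
    (univ.filter fun p => coarseTermMap₂ τ h p = finProdFinEquiv (t, cidx)) =
      univ.filter fun p => halfTermOf τ p = t ∧ coarseClassOf I J K p = ((coarseClasses c).equivFin.symm cidx).1 := by
  ext p
  simp only [mem_filter, mem_univ, true_and, coarseTermMap₂, EmbeddingLike.apply_eq_iff_eq, Prod.mk.injEq]
  refine and_congr Iff.rfl ?_
  rw [coarseTermMap, Equiv.apply_eq_iff_eq_symm_apply]
  constructor
  · intro ht; exact congrArg Subtype.val ht
  · intro ht; exact Subtype.ext ht

/-- The fibre over a border class is `S_{t,i',j',k'}`. [cite: VassilevskaWilliamsXuXuZhou2024, Def. 6.14 (1)] -/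
theorem filter_halfTerm_coarseClassOf_some {I J K : Fin (n + n) → ℕ} (t : Fin s) {i j k : ℕ} (hb : i = 0 ∨ j = 0) :
    (univ.filter fun p => halfTermOf τ p = t ∧ coarseClassOf I J K p = (some (i, j), k)) = pairClass τ I J K t i j k := by
  ext p
  rw [mem_filter, mem_pairClass]
  have := Finset.ext_iff.1 (filter_coarseClassOf_some (I := I) (J := J) (K := K) (k := k) hb) p
  simp only [mem_filter, mem_univ, true_and, mem_posClass] at this
  simp only [mem_univ, true_and]
  rw [this]

/-- The fibre over `(t, none, k')` is `S_{t,+,+,k'}`. [cite: VassilevskaWilliamsXuXuZhou2024, Def. 6.14 (2)] -/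
theorem filter_halfTerm_coarseClassOf_none {I J K : Fin (n + n) → ℕ} (t : Fin s) {k : ℕ} :
    (univ.filter fun p => halfTermOf τ p = t ∧ coarseClassOf I J K p = (none, k)) = pairClassPP τ I J K t k := by
  ext p
  rw [mem_filter, mem_pairClassPP]
  have := Finset.ext_iff.1 (filter_coarseClassOf_none (I := I) (J := J) (K := K) (k := k)) p
  simp only [mem_filter, mem_univ, true_and, mem_posClassPP] at this
  simp only [mem_univ, true_and]
  rw [this]

variable (L : Fin s → InterfaceTerm (c + c))

/-- **Compatible blocks are admissible for the coarse datum** (Def. 6.9 ⇒ Def. 6.14): for an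
`{α_t}`-consistent triple inside the level-`ℓ` blocks, a level-1 `Z`-sequence in `Z_K` compatible with
it is an exact level-1 `X`-block of the coarse one-level datum with `βPP = β̄_{Z,·,+,+,·}`.
[cite: VassilevskaWilliamsXuXuZhou2024, Def. 6.14 and Claim 6.13 (proof)] -/
theorem mem_levelBlocksX_coarse₂_of_compatible {βZ : Fin s → ℕ × ℕ × ℕ → (Fin c → Fin 3) → ℝ} {cnt : Fin s → ℕ × ℕ × ℕ → ℕ}
    {I J K : Fin (n + n) → Fin (2 * c + 1)} (h : IsLevelTriple c (seqVal I) (seqVal J) (seqVal K))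
    (hI : InsideX τ L I) (hJ : InsideY τ L J) (hK : InsideZ τ L K) (hcnt : IsAlphaTConsistent τ cnt (seqVal I) (seqVal J) (seqVal K))
    {Kh : Fin (n + n) → Fin c → Fin 3} (hblk : chunkLevels Kh = seqVal K)
    (hc : IsCompatibleWith₂ τ L (fun t ijk => (cnt t ijk : ℝ)) βZ (seqVal I) (seqVal J) (seqVal K) Kh) :
    Kh ∈ levelBlocksX (coarseTermMap₂ τ h)
      (coarseTermList₂ c s βZ fun t k => betaBarPP c (L t) (fun ijk => (cnt t ijk : ℝ)) (βZ t) k) 0 := by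
  rw [levelBlocksX, mem_admissibleSeqs]
  refine ⟨fun p => ?_, fun idx hne => ?_⟩
  · -- levels: the `Z`-level of the class of `p` is `K p`
    simp only [coarseTermList₂, coarseTermMap₂, Equiv.symm_apply_apply, coarseTermMap]
    have : (coarseClassOf (seqVal I) (seqVal J) (seqVal K) p).2 = seqVal K p := by
      unfold coarseClassOf; split_ifs <;> rfl
    rw [this]
    exact congrFun hblk p
  · obtain ⟨⟨t, cidx⟩, rfl⟩ := finProdFinEquiv.surjective idx
    rw [filter_coarseTermMap₂_eq] at hne ⊢
    rw [splitConsistentOn_zero_iff]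
    simp only [coarseTermList₂, Equiv.symm_apply_apply]
    generalize hcs : (coarseClasses c).equivFin.symm cidx = cs at hne ⊢
    obtain ⟨cl, hcl⟩ := cs
    rcases cl with ⟨_ | ⟨i, j⟩, k⟩
    · rw [filter_halfTerm_coarseClassOf_none] at hne ⊢
      simpa [coarseBeta] using completeSplitOn_pairClassPP_of_compatible τ L h hI hJ hK hcnt hc t k hne
    · have hb : i = 0 ∨ j = 0 := by
        rcases mem_union.1 hcl with hcl | hcl
        · obtain ⟨ijk, hijk, he⟩ := mem_image.1 hcl
          simp only [Prod.mk.injEq, Option.some.injEq] at he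
          obtain ⟨⟨rfl, rfl⟩, -⟩ := he
          exact (mem_filter.1 hijk).2
        · obtain ⟨k', -, he⟩ := mem_image.1 hcl
          simp at he
      rw [filter_halfTerm_coarseClassOf_some τ t hb] at hne ⊢
      simpa [coarseBeta] using hc.1 t i j k hb hne

end Coarse

/-! ## `C(T)` is at most the coarse block count, which is at most `2^{∑ |class| H}` -/

namespace ConstituentRegion

open scoped Classical

variable {c n s M : ℕ} {D : ConstituentRegion c n s M}

/-- The coarse parameter list of the region. [cite: VassilevskaWilliamsXuXuZhou2024, Def. 6.14] -/
abbrev coarseList (D : ConstituentRegion c n s M) : Fin (s * (coarseClasses c).card) → InterfaceTerm c :=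
  coarseTermList₂ c s D.βZ fun t k => betaBarPP c (D.L t) (fun ijk => (D.cnt t ijk : ℝ)) (D.βZ t) k

/-- **`C(T) ≤ |levelBlocksX (coarse datum of T) 0|`** for an `{α_t}`-consistent triple. [cite: VassilevskaWilliamsXuXuZhou2024, Claim 6.13 (proof) and Def. 6.14] -/
theorem compatCount_le_card_coarse (hD : D.WellFormed)
    {T : (Fin (n + n) → Fin (2 * c + 1)) × (Fin (n + n) → Fin (2 * c + 1)) × (Fin (n + n) → Fin (2 * c + 1))} (hT : T ∈ D.consistent)
    (h : IsLevelTriple c (seqVal T.1) (seqVal T.2.1) (seqVal T.2.2)) :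
    D.compatCount T ≤ (levelBlocksX (coarseTermMap₂ D.τ h) D.coarseList 0).card := by
  obtain ⟨hTu, hcnt⟩ := mem_filter.1 hT
  obtain ⟨-, hI, hJ, hK⟩ := tripleSet_good hD hTu
  refine card_le_card fun Kh hKh => ?_
  obtain ⟨-, hblk, hc⟩ := mem_filter.1 hKh
  rw [toHashed_CZ] at hc
  exact mem_levelBlocksX_coarse₂_of_compatible D.τ D.L h hI hJ hK hcnt ((chunkLevels_eq_iff).2 hblk) hc

/-- **`C(T) ≤ 2^{∑_{(t,class)} |class| · H(β of the class)}`** — the printed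
`∏ 2^{H(β_{Z,t,i',j',k'}) |S_{t,i',j',k'}|} · ∏ 2^{H(β̄_{Z,t,+,+,k'}) |S_{t,+,+,k'}|} = 2^{∑_t λ_{Z,t} A_{t,1} n_t}`
in exact form (an exact block set is the multi-class type class of any of its members, Lemma 3.3).
[cite: VassilevskaWilliamsXuXuZhou2024, Claim 6.13 (proof)] -/
theorem compatCount_le_two_rpow (hD : D.WellFormed)
    {T : (Fin (n + n) → Fin (2 * c + 1)) × (Fin (n + n) → Fin (2 * c + 1)) × (Fin (n + n) → Fin (2 * c + 1))} (hT : T ∈ D.consistent)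
    (h : IsLevelTriple c (seqVal T.1) (seqVal T.2.1) (seqVal T.2.2)) :
    (D.compatCount T : ℝ) ≤
      2 ^ (∑ idx, ((classOf (coarseTermMap₂ D.τ h) idx).card : ℝ) * shannonEntropy (D.coarseList idx).γX) := by
  have hle := compatCount_le_card_coarse hD hT h
  set blocks := levelBlocksX (coarseTermMap₂ D.τ h) D.coarseList 0 with hblocks
  rcases blocks.eq_empty_or_nonempty with hbe | ⟨Kh₀, h₀⟩
  · rw [hbe, card_empty, Nat.le_zero] at hle
    rw [hle, Nat.cast_zero]; positivity
  -- the blocks are the multi-class type class of `Kh₀`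
  have h₀' : Kh₀ ∈ admissibleSeqs (coarseTermMap₂ D.τ h) (fun idx => (D.coarseList idx).i) (fun idx => (D.coarseList idx).γX) 0 := h₀
  have hMTC := admissibleSeqs_zero_eq_multiTypeClass (coarseTermMap₂ D.τ h) (fun idx => (D.coarseList idx).i) (fun idx => (D.coarseList idx).γX) h₀'
  set k₀ : Fin (s * (coarseClasses c).card) → (Fin c → Fin 3) → ℕ := fun g a => countOn (classOf (coarseTermMap₂ D.τ h) g) Kh₀ a with hk₀
  have hk : ∀ g, ∑ a, k₀ g a = Fintype.card {x // coarseTermMap₂ D.τ h x = g} := fun g =>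
    sum_eq_card_of_mem_multiTypeClass (hMTC ▸ h₀') g
  have hbound := card_multiTypeClass_le_two_rpow (coarseTermMap₂ D.τ h) k₀ hk
  have hcardeq : blocks.card = (multiTypeClass (coarseTermMap₂ D.τ h) k₀).card := by
    rw [hblocks, levelBlocksX]; exact congrArg Finset.card hMTC
  -- on an occurring class the type of `Kh₀` is the exact split of the class
  have hH : ∀ g, (classOf (coarseTermMap₂ D.τ h) g).Nonempty →
      (fun a => (k₀ g a : ℝ) / Fintype.card {x // coarseTermMap₂ D.τ h x = g}) = (D.coarseList g).γX := by
    intro g hgne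
    have hsplit := (mem_admissibleSeqs.1 h₀').2 g hgne
    rw [splitConsistentOn_zero_iff] at hsplit
    rw [← hsplit]
    funext a
    rw [completeSplitOn_apply, card_subtype_classOf]
    show ((countOn (classOf (coarseTermMap₂ D.τ h) g) Kh₀ a : ℕ) : ℝ) / _ = _
    rw [countOn_apply]
  have hsum : ∑ g, (Fintype.card {x // coarseTermMap₂ D.τ h x = g} : ℝ) *
      shannonEntropy (fun a => (k₀ g a : ℝ) / Fintype.card {x // coarseTermMap₂ D.τ h x = g}) =
      ∑ idx, ((classOf (coarseTermMap₂ D.τ h) idx).card : ℝ) * shannonEntropy (D.coarseList idx).γX := by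
    refine sum_congr rfl fun g _ => ?_
    rw [card_subtype_classOf]
    rcases (classOf (coarseTermMap₂ D.τ h) g).eq_empty_or_nonempty with hge | hgne
    · rw [hge, card_empty, Nat.cast_zero, zero_mul, zero_mul]
    · rw [← card_subtype_classOf, hH g hgne, card_subtype_classOf]
  calc (D.compatCount T : ℝ) ≤ blocks.card := by exact_mod_cast hle
    _ = (multiTypeClass (coarseTermMap₂ D.τ h) k₀).card := by rw [hcardeq]
    _ ≤ _ := hbound
    _ = _ := by rw [hsum]

end ConstituentRegion

end Literature.Computability.AlgebraicComplexity
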